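import Literature.NumberTheory.GaloisRepresentations.AbsDecompositionIndex
import Literature.NumberTheory.GaloisRepresentations.NeukirchUchidaKummerPackage
import Literature.AnabelianGeometry.AbsoluteAnabelian.NeukirchUchidaKummerSeparation
import HarnessLib

/-!
# The Neukirch–Uchida deduction, row R10b (part 1): the Chinese-remainder element for a pair of primes

J. Neukirch, A. Schmidt, K. Wingberg, *Cohomology of Number Fields* (2nd ed.), Thm. (12.2.1), proof —
abc-iut sub-DAG `plan/L4/SUBDAG-NeukirchUchida.md`, row R10b (the data feeding the Kummer separation
`inv_mul_mem_of_map_stabilizer_eq`, `NeukirchUchidaKummerSeparation.lean`): for a finite Galois `M/F`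
inside `F̄`, two primes `v₀ ≠ v₁` of `F` splitting completely in `M`, nonarchimedean primes `A₀, A₁` of
`F̄` over them and arbitrary targets `t₀, t₁ ∈ 𝓞 M`, the Chinese remainder theorem
(`exists_forall_sub_mem_of_isMaximal`, abc-iut-w5-d047) over the primes of `M` above `v₀, v₁` produces
`b ∈ 𝓞 M` with `b ≡ tᵢ` at the prime below `Aᵢ` and `g • b ≡ 1 (mod 𝔪_{Aᵢ})` for every `g ∈ Γ ∖ Γ_M` —
the latter because `Gal(M/F)` acts FREELY on the primes over a completely split prime
(`inv_mul_mem_of_mem_splitPrimes`, abc-iut-w5-d201), so `g⁻¹ • Aᵢ` lies over a different prime of `M`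
where the target is `1` (`exists_crt_element`).

PROOF-ONLY (0 `def`s).  HONEST FRAMING: classical, outside the [IUTchIII] Cor. 3.12 cone; nothing here
takes a side.

## References
* [NeukirchSchmidtWingberg2008] Neukirch–Schmidt–Wingberg, *Cohomology of Number Fields*, Thm. (12.2.1).
* [NeukirchANT1999] J. Neukirch, *Algebraic Number Theory*, Ch. I §9, Ch. II §9.
-/

noncomputable section

open scoped Pointwise NumberField
open Field NumberField IsDedekindDomain
open Literature.NumberTheory.GaloisRepresentations
open Literature.NumberTheory.GaloisRepresentations.NeukirchUchidaProof

namespace Literature.AnabelianGeometry.AbsoluteAnabelian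

namespace NeukirchUchidaProof

variable {F : Type} [Field F] [NumberField F] (M : IntermediateField F (AlgebraicClosure F))
  [FiniteDimensional F M]

omit [NumberField F] in
/-- A conjugate `g⁻¹ • A` of a prime `A` over `v` is again over `v` (the base field is fixed by `Γ`).
[cite: NeukirchANT1999, Ch. II §9 (9.1)] -/
theorem below_base_smul {A : ValuationSubring (AlgebraicClosure F)} {v : HeightOneSpectrum (𝓞 F)}
    (hv : ∀ r : 𝓞 F, algebraMap F (AlgebraicClosure F) r ∈ A.nonunits ↔ r ∈ v.asIdeal)
    (g : absoluteGaloisGroup F) :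
    ∀ r : 𝓞 F, algebraMap F (AlgebraicClosure F) r ∈ (g • A).nonunits ↔ r ∈ v.asIdeal := by
  intro r
  rw [mem_nonunits_smul_iff, ← hv r]
  have : g⁻¹ • algebraMap F (AlgebraicClosure F) (r : F) = algebraMap F (AlgebraicClosure F) (r : F) :=
    smul_algebraMap g⁻¹ (r : F)
  rw [this]

/-- **The Chinese-remainder element for a pair of primes** (row R10b, data for the Kummer separation
`inv_mul_mem_of_map_stabilizer_eq`).  `M/F` finite Galois inside `F̄`, `v₀ ≠ v₁` primes of `F` splitting
completely in `M`, `A₀, A₁` nonarchimedean primes of `F̄` over `v₀, v₁` lying over the primes `P₀, P₁` of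
`𝓞 M`, and targets `t₀, t₁ ∈ 𝓞 M`.  Then some `b ∈ 𝓞 M` has `b ≡ t₀ (mod P₀)`, `b ≡ t₁ (mod P₁)` and
`g • b ≡ 1 (mod 𝔪_{A₀})`, `g • b ≡ 1 (mod 𝔪_{A₁})` for EVERY `g ∈ Γ ∖ Γ_M`: by the Chinese remainder
theorem with target `1` at all the other primes of `M` over `v₀, v₁` — for `g ∉ Γ_M` the prime below
`g⁻¹ • A_i` is another prime over `v_i` (free action of `Gal(M/F)` on the primes over a completely split
prime, `inv_mul_mem_of_mem_splitPrimes`). [cite: NeukirchSchmidtWingberg2008, Thm (12.2.1)] -/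
theorem exists_crt_element [IsGalois F M] {v₀ v₁ : HeightOneSpectrum (𝓞 F)} (hne : v₀ ≠ v₁)
    (hs₀ : v₀ ∈ splitPrimes F M) (hs₁ : v₁ ∈ splitPrimes F M)
    {A₀ A₁ : ValuationSubring (AlgebraicClosure F)} (hA₀ : A₀ ≠ ⊤) (hA₁ : A₁ ≠ ⊤)
    (hv₀ : ∀ r : 𝓞 F, algebraMap F (AlgebraicClosure F) r ∈ A₀.nonunits ↔ r ∈ v₀.asIdeal)
    (hv₁ : ∀ r : 𝓞 F, algebraMap F (AlgebraicClosure F) r ∈ A₁.nonunits ↔ r ∈ v₁.asIdeal)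
    {P₀ P₁ : Ideal (𝓞 M)}
    (hP₀ : ∀ x : 𝓞 M, ((x : M) : AlgebraicClosure F) ∈ A₀.nonunits ↔ x ∈ P₀)
    (hP₁ : ∀ x : 𝓞 M, ((x : M) : AlgebraicClosure F) ∈ A₁.nonunits ↔ x ∈ P₁) (t₀ t₁ : 𝓞 M) :
    ∃ b : 𝓞 M, b - t₀ ∈ P₀ ∧ b - t₁ ∈ P₁ ∧
      (∀ g : absoluteGaloisGroup F,
        g ∉ M.fixingSubgroup.comap (absoluteGaloisGroup.toAlgEquiv F).toMonoidHom →
          g • ((b : M) : AlgebraicClosure F) - 1 ∈ A₀.nonunits) ∧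
      ∀ g : absoluteGaloisGroup F,
        g ∉ M.fixingSubgroup.comap (absoluteGaloisGroup.toAlgEquiv F).toMonoidHom →
          g • ((b : M) : AlgebraicClosure F) - 1 ∈ A₁.nonunits := by
  classical
  haveI : NumberField M := NumberField.of_module_finite F M
  -- the finite set of primes of `M` over `v₀` or `v₁`
  have hfin : (v₀.asIdeal.primesOver (𝓞 M) ∪ v₁.asIdeal.primesOver (𝓞 M)).Finite :=
    (IsDedekindDomain.primesOver_finite v₀.asIdeal (𝓞 M)).union
      (IsDedekindDomain.primesOver_finite v₁.asIdeal (𝓞 M))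
  set s : Finset (Ideal (𝓞 M)) := hfin.toFinset with hs
  have hmem : ∀ P, P ∈ s ↔ P ∈ v₀.asIdeal.primesOver (𝓞 M) ∨ P ∈ v₁.asIdeal.primesOver (𝓞 M) :=
    fun P => by rw [hs, Set.Finite.mem_toFinset, Set.mem_union]
  have hP₀mem : P₀ ∈ v₀.asIdeal.primesOver (𝓞 M) := mem_primesOver_of_below M hA₀ hP₀ hv₀
  have hP₁mem : P₁ ∈ v₁.asIdeal.primesOver (𝓞 M) := mem_primesOver_of_below M hA₁ hP₁ hv₁
  -- targets
  let t : Ideal (𝓞 M) → 𝓞 M := fun P => if P = P₀ then t₀ else if P = P₁ then t₁ else 1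
  have hmax : ∀ P ∈ s, P.IsMaximal := by
    intro P hP
    rcases (hmem P).mp hP with h | h
    · exact Ideal.isMaximal_of_mem_primesOver h
    · exact Ideal.isMaximal_of_mem_primesOver h
  obtain ⟨b, hb⟩ := exists_forall_sub_mem_of_isMaximal s id hmax (fun _ _ _ _ h => h) t
  -- `P₀ ≠ P₁`: they lie over different primes of `F`
  have hP₀₁ : P₀ ≠ P₁ := by
    intro h
    apply hne
    have h0 := hP₀mem.2
    have h1 := hP₁mem.2
    rw [h] at h0
    have e : v₀.asIdeal = v₁.asIdeal := by
      rw [h0.over, h1.over]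
    exact HeightOneSpectrum.ext e
  refine ⟨b, ?_, ?_, ?_, ?_⟩
  · have := hb P₀ ((hmem P₀).mpr (Or.inl hP₀mem))
    simpa [t] using this
  · have := hb P₁ ((hmem P₁).mpr (Or.inr hP₁mem))
    simpa [t, hP₀₁.symm] using this
  · -- at `A₀`
    intro g hg
    -- the prime `P'` of `M` below `g⁻¹ • A₀`
    have hA' : g⁻¹ • A₀ ≠ ⊤ := by
      intro h
      apply hA₀
      rw [eq_top_iff]
      intro x _
      have hx : g⁻¹ • x ∈ g⁻¹ • A₀ := by rw [h]; exact ValuationSubring.mem_top _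
      rwa [ValuationSubring.mem_pointwise_smul_iff_inv_smul_mem, inv_smul_smul] at hx
    have hv' := below_base_smul hv₀ g⁻¹
    obtain ⟨P', hP'A, -⟩ := existsUnique_ideal_below M (g⁻¹ • A₀)
    have hP'mem : P' ∈ v₀.asIdeal.primesOver (𝓞 M) := mem_primesOver_of_below M hA' hP'A hv'
    -- `P' ≠ P₀` by the free action over the completely split `v₀`
    have hP'0 : P' ≠ P₀ := by
      intro h
      apply hg
      rw [h] at hP'A
      have h1 := inv_mul_mem_of_mem_splitPrimes M hA₀ hv₀ hs₀ (P := P₀) (σ := 1) (σ' := g⁻¹)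
        (by simpa only [one_smul] using hP₀) hP'A
      rw [inv_one, one_mul] at h1
      exact (Subgroup.inv_mem_iff _).mp h1
    have hP'1 : P' ≠ P₁ := by
      intro h
      rw [h] at hP'mem
      exact hne (HeightOneSpectrum.ext (by rw [hP'mem.2.over, hP₁mem.2.over]))
    have hb' := hb P' ((hmem P').mpr (Or.inl hP'mem))
    simp only [t, id, hP'0, hP'1, if_false] at hb'
    -- `b ≡ 1 (mod 𝔪_{g⁻¹ A₀})`, i.e. `g • b ≡ 1 (mod 𝔪_{A₀})`
    have h2 : ((b : M) : AlgebraicClosure F) - 1 ∈ (g⁻¹ • A₀).nonunits := by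
      have := coe_sub_mem_nonunits_of_sub_mem (g⁻¹ • A₀) (q := P') hP'A hb'
      simpa using this
    rw [mem_nonunits_smul_iff, inv_inv, smul_sub, smul_one] at h2
    exact h2
  · -- at `A₁` (same argument with the roles of `v₀`, `v₁` exchanged)
    intro g hg
    have hA' : g⁻¹ • A₁ ≠ ⊤ := by
      intro h
      apply hA₁
      rw [eq_top_iff]
      intro x _
      have hx : g⁻¹ • x ∈ g⁻¹ • A₁ := by rw [h]; exact ValuationSubring.mem_top _
      rwa [ValuationSubring.mem_pointwise_smul_iff_inv_smul_mem, inv_smul_smul] at hx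
    have hv' := below_base_smul hv₁ g⁻¹
    obtain ⟨P', hP'A, -⟩ := existsUnique_ideal_below M (g⁻¹ • A₁)
    have hP'mem : P' ∈ v₁.asIdeal.primesOver (𝓞 M) := mem_primesOver_of_below M hA' hP'A hv'
    have hP'1 : P' ≠ P₁ := by
      intro h
      apply hg
      rw [h] at hP'A
      have h1 := inv_mul_mem_of_mem_splitPrimes M hA₁ hv₁ hs₁ (P := P₁) (σ := 1) (σ' := g⁻¹)
        (by simpa only [one_smul] using hP₁) hP'A
      rw [inv_one, one_mul] at h1
      exact (Subgroup.inv_mem_iff _).mp h1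
    have hP'0 : P' ≠ P₀ := by
      intro h
      rw [h] at hP'mem
      exact hne (HeightOneSpectrum.ext (by rw [hP₀mem.2.over, hP'mem.2.over]))
    have hb' := hb P' ((hmem P').mpr (Or.inr hP'mem))
    simp only [t, id, hP'0, hP'1, if_false] at hb'
    have h2 : ((b : M) : AlgebraicClosure F) - 1 ∈ (g⁻¹ • A₁).nonunits := by
      have := coe_sub_mem_nonunits_of_sub_mem (g⁻¹ • A₁) (q := P') hP'A hb'
      simpa using this
    rw [mem_nonunits_smul_iff, inv_inv, smul_sub, smul_one] at h2
    exact h2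

end NeukirchUchidaProof

end Literature.AnabelianGeometry.AbsoluteAnabelian

end
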